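import Summits.QuantumFields.YangMills.Theorems.ColdStartUniversalityLatticeLangevinStrongFeller
import Summits.QuantumFields.YangMills.Theorems.ColdStartUniversalityLatticeLangevinRiemannW1ColdStartMixing
import Summits.QuantumFields.YangMills.Theorems.ColdStartUniversalityLatticeLangevinCocycleMain
import Summits.QuantumFields.YangMills.Theorems.ColdStartUniversalityShenZhuZhuW1GeometricErgodicitySU2
import Mathlib.MeasureTheory.Function.ContinuousMapDense
import HarnessLib

/-!
# TOTAL-VARIATION form of the strong Feller property and EVERY-START TOTAL-VARIATION ERGODICITY of the `SU(2)` lattice Langevin dynamics on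
# `(ℤ/L)³`, `|β'| < 1/12`:  `|κ_t(Q',A) − κ_t(Q,A)| ≤ C_t·ρ_L(Q,Q')` for every Borel set `A`, and
# `|κ_(t+s)(Q,A) − μ_(β')(A)| ≤ C_s·e^(−(1−12|β'|)t)·∫ρ_L(Q,·)dμ_(β') ≤ C_s·e^(−(1−12|β'|)t)·√2·π·√#E`, `C_s = √((1−12|β'|)/(e^(2(1−12|β'|)s) − 1))`

Seat `ym-line-csu-p1` (g42), route `ColdStartUniversality` of `Summits/QuantumFields/YangMills`, helper file G67 (`--supports stmt-QuantumFields-24809`).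
G61 proved the strong Feller bound `|κ_tG(Q') − κ_tG(Q)| ≤ C_t·M·ρ_L(Q,Q')` for bounded SEMICONTINUOUS `G`.  §1 extends it to every bounded BOREL `G`
(density of bounded continuous functions in `L¹(κ_t(Q,·) + κ_t(Q',·))`, Mathlib `Integrable.exists_boundedContinuous_integral_sub_le`, after clamping
to `[0, M]`), i.e. `x ↦ κ_t(x,·)` is `C_t`-Lipschitz from `(SU(2)^E, ρ_L)` to total variation.  §2 combines it with the `W₁` cold-start mixing of G55 and
Chapman–Kolmogorov (`chapmanKolmogorov_szz`) + invariance of the Wilson–Gibbs law: a Harris-free, every-start TOTAL-VARIATION geometric ergodicity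
with explicit, volume-uniform rate `1 − 12|β'|` and prefactor `C_s·√2π·√#E`.

* ★★★ `wilson_strongFeller_measurable` — `|∫G dκ_t(Q') − ∫G dκ_t(Q)| ≤ C_t·M·ρ_L(Q,Q')` for every measurable `0 ≤ G ≤ M`, `t > 0`;
* ★★★ `wilson_strongFeller_set` — `|κ_t(Q')(A) − κ_t(Q)(A)| ≤ C_t·ρ_L(Q,Q')` (real parts) for every measurable set `A`;
* ★★★ `wilson_tv_ergodicity_everyStart` — `|κ_(t+s)(Q)(A) − μ_(β')(A)| ≤ C_s·e^(−(1−12|β'|)t)·∫ρ_L(Q,·)dμ_(β')` for all measurable `A`, every start `Q`,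
  `s > 0`, `t ≥ 0`;  ★★★ `wilson_tv_ergodicity_everyStart_diam` — `≤ C_s·e^(−(1−12|β'|)t)·√2·π·√#E`.

THEOREMS ONLY, no definition, no sorry.  HONEST FRAMING: fixed cut-off, finite volume, `|β'| < 1/12`; the prefactor grows like `√#E` (volume enters
only there); nothing `K`-uniform along the route's scaling; `UniformColdStartMixing` (24809, ASIDE) is not restated; no crux, rung or summit statement is
proved; the Yang–Mills mass gap is NOT proved.
-/

set_option autoImplicit false

noncomputable section

namespace Summit.QuantumFields.YangMills.Theorems.ColdStartUniversality

open MeasureTheory ProbabilityTheory Matrix Complex Finset Filter Topology Set Metric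
open scoped BigOperators NNReal ENNReal BoundedContinuousFunction
open Literature.MathematicalPhysics.QuantumFieldTheory
open Literature.MathematicalPhysics.QuantumLattice (fundamentalRep fundamentalLatticeRep continuous_fundamentalRep fundamentalRep_apply fundamentalLatticeRep_N)

variable {L : ℕ} [NeZero L]

/-! ## §1. Strong Feller for bounded Borel observables and for sets -/

/-- ★★★ **Strong Feller property, bounded BOREL observables.**  For `|β'| < 1/12`, `t > 0`, every realising kernel family `κ` and every measurable `G`
with `0 ≤ G ≤ M`:  `|∫G dκ_t(Q') − ∫G dκ_t(Q)| ≤ √((1−12|β'|)/(e^(2(1−12|β'|)t) − 1))·M·ρ_L(Q,Q')` (G61 for continuous functions + density of bounded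
continuous functions in `L¹`, clamped to `[0,M]`). [cite: BakryGentilLedoux2014, Thm 4.7.2 (iii) / (4.7.6)] -/
theorem wilson_strongFeller_measurable (L : ℕ) [NeZero L] (β' : ℝ) (hβ : |β'| < 1 / 12)
    (κ : ℝ≥0 → Kernel (GaugeConfig 3 L (Matrix.specialUnitaryGroup (Fin 2) ℂ))
      (GaugeConfig 3 L (Matrix.specialUnitaryGroup (Fin 2) ℂ))) [∀ t, IsMarkovKernel (κ t)]
    (hreal : ∀ (t : ℝ≥0) (x : GaugeConfig 3 L (Matrix.specialUnitaryGroup (Fin 2) ℂ))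
        (Ω : Type) [MeasurableSpace Ω] (P : Measure Ω) [IsProbabilityMeasure P]
        (W : ℝ≥0 → Ω → (Edge 3 L × NoiseIdx 2 → ℝ)) (hW : IsFlatBrownian W P)
        (U : ℝ≥0 → Ω → GaugeConfig 3 L (Matrix.specialUnitaryGroup (Fin 2) ℂ)),
        (∀ ω, U 0 ω = x) →
        (latticeLangevinDynamics (fundamentalLatticeRep 2) β').IsSolution (fundamentalRep (Fin 2))
          hW.natFiltration P W U →
        κ t x = P.map (U t))
    {G : GaugeConfig 3 L (Matrix.specialUnitaryGroup (Fin 2) ℂ) → ℝ} (hGm : Measurable G)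
    {M : ℝ} (h0 : ∀ y, 0 ≤ G y) (hM : ∀ y, G y ≤ M) {t : ℝ≥0} (ht : 0 < (t : ℝ))
    (Q Q' : GaugeConfig 3 L (Matrix.specialUnitaryGroup (Fin 2) ℂ)) :
    |∫ y, G y ∂(κ t Q') - ∫ y, G y ∂(κ t Q)| ≤
      Real.sqrt ((1 - 12 * |β'|) / (Real.exp (2 * (1 - 12 * |β'|) * (t : ℝ)) - 1)) * M *
        Real.sqrt (torusRiemannDistSq (fundamentalLatticeRep 2) Q Q') := by
  classical
  haveI := secondCountableTopology_su2
  haveI := borelSpace_config L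
  -- the reference measure `μ = κ_t(Q) + κ_t(Q')`
  have hGi : ∀ ν : Measure (GaugeConfig 3 L (Matrix.specialUnitaryGroup (Fin 2) ℂ)), IsFiniteMeasure ν → Integrable G ν := fun ν hν =>
    (memLp_of_bounded (a := 0) (b := M) (ae_of_all _ fun y => ⟨h0 y, hM y⟩) hGm.aestronglyMeasurable 1).integrable le_rfl
  refine le_of_forall_pos_le_add fun ε hε => ?_
  obtain ⟨g, hg, -⟩ := (hGi (κ t Q + κ t Q') inferInstance).exists_boundedContinuous_integral_sub_le (half_pos hε)
  -- clamp to `[0, M]`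
  have hM0 : 0 ≤ M := (h0 Q).trans (hM Q)
  have hcl : Continuous fun y => max 0 (min M (g y)) := continuous_const.max (continuous_const.min g.continuous)
  have hcl0 : ∀ y, 0 ≤ max 0 (min M (g y)) := fun y => le_max_left _ _
  have hclM : ∀ y, max 0 (min M (g y)) ≤ M := fun y => max_le hM0 (min_le_left _ _)
  have hclose : ∀ y, |G y - max 0 (min M (g y))| ≤ ‖G y - g y‖ := by
    intro y
    rw [Real.norm_eq_abs]
    have h1 := h0 y; have h2 := hM y
    rcases le_total (g y) 0 with hg0 | hg0
    · rw [min_eq_right (hg0.trans hM0), max_eq_left hg0, sub_zero, abs_of_nonneg h1]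
      have : G y ≤ G y - g y := by linarith
      exact this.trans (le_abs_self _)
    · rcases le_total M (g y) with hgM | hgM
      · rw [min_eq_left hgM, max_eq_right hM0]
        have : |G y - M| = M - G y := by rw [abs_sub_comm]; exact abs_of_nonneg (by linarith)
        rw [this]
        have : G y - g y ≤ 0 := by linarith
        rw [abs_of_nonpos this]; linarith
      · rw [min_eq_right hgM, max_eq_right hg0]
  -- the two approximation errors
  have herr : ∀ ν : Measure (GaugeConfig 3 L (Matrix.specialUnitaryGroup (Fin 2) ℂ)), IsProbabilityMeasure ν → ν ≤ κ t Q + κ t Q' →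
      |∫ y, G y ∂ν - ∫ y, max 0 (min M (g y)) ∂ν| ≤ ε / 2 := by
    intro ν hν hle
    have hci : Integrable (fun y => max 0 (min M (g y))) ν := hcl.integrable_of_hasCompactSupport (HasCompactSupport.of_compactSpace _)
    rw [← integral_sub (hGi ν inferInstance) hci]
    have hdi : Integrable (fun y => ‖G y - g y‖) (κ t Q + κ t Q') :=
      ((hGi _ inferInstance).sub (g.continuous.integrable_of_hasCompactSupport (HasCompactSupport.of_compactSpace _))).norm
    calc |∫ y, (G y - max 0 (min M (g y))) ∂ν| ≤ ∫ y, |G y - max 0 (min M (g y))| ∂ν := abs_integral_le_integral_abs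
      _ ≤ ∫ y, ‖G y - g y‖ ∂ν := integral_mono_of_nonneg (ae_of_all _ fun _ => abs_nonneg _) (hdi.mono_measure hle) (ae_of_all _ hclose)
      _ ≤ ∫ y, ‖G y - g y‖ ∂(κ t Q + κ t Q') := integral_mono_measure hle (ae_of_all _ fun _ => norm_nonneg _) hdi
      _ ≤ ε / 2 := hg
  have hQle : κ t Q ≤ κ t Q + κ t Q' := Measure.le_add_right le_rfl
  have hQ'le : κ t Q' ≤ κ t Q + κ t Q' := Measure.le_add_left le_rfl
  have e1 := herr (κ t Q) inferInstance hQle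
  have e2 := herr (κ t Q') inferInstance hQ'le
  -- G61 for the clamped continuous approximant
  have hmid := wilson_strongFeller_upperSemicontinuous L β' hβ κ hreal hcl.upperSemicontinuous hcl0 hclM ht Q Q'
  have h3 := abs_sub_le (∫ y, G y ∂(κ t Q')) (∫ y, max 0 (min M (g y)) ∂(κ t Q')) (∫ y, G y ∂(κ t Q))
  have h4 := abs_sub_le (∫ y, max 0 (min M (g y)) ∂(κ t Q')) (∫ y, max 0 (min M (g y)) ∂(κ t Q)) (∫ y, G y ∂(κ t Q))
  rw [abs_sub_comm] at e1
  linarith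

/-- ★★★ **Strong Feller property on sets: `x ↦ κ_t(x,·)` is `C_t`-Lipschitz from `(SU(2)^E, ρ_L)` to total variation.**  For every measurable `A`,
`t > 0`:  `|κ_t(Q')(A) − κ_t(Q)(A)| ≤ √((1−12|β'|)/(e^(2(1−12|β'|)t) − 1))·ρ_L(Q,Q')` (real parts; §1 with `G = 𝟙_A`). [cite: BakryGentilLedoux2014, Thm 4.7.2 (iii) / (4.7.6)] -/
theorem wilson_strongFeller_set (L : ℕ) [NeZero L] (β' : ℝ) (hβ : |β'| < 1 / 12)
    (κ : ℝ≥0 → Kernel (GaugeConfig 3 L (Matrix.specialUnitaryGroup (Fin 2) ℂ))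
      (GaugeConfig 3 L (Matrix.specialUnitaryGroup (Fin 2) ℂ))) [∀ t, IsMarkovKernel (κ t)]
    (hreal : ∀ (t : ℝ≥0) (x : GaugeConfig 3 L (Matrix.specialUnitaryGroup (Fin 2) ℂ))
        (Ω : Type) [MeasurableSpace Ω] (P : Measure Ω) [IsProbabilityMeasure P]
        (W : ℝ≥0 → Ω → (Edge 3 L × NoiseIdx 2 → ℝ)) (hW : IsFlatBrownian W P)
        (U : ℝ≥0 → Ω → GaugeConfig 3 L (Matrix.specialUnitaryGroup (Fin 2) ℂ)),
        (∀ ω, U 0 ω = x) →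
        (latticeLangevinDynamics (fundamentalLatticeRep 2) β').IsSolution (fundamentalRep (Fin 2))
          hW.natFiltration P W U →
        κ t x = P.map (U t))
    {A : Set (GaugeConfig 3 L (Matrix.specialUnitaryGroup (Fin 2) ℂ))} (hA : MeasurableSet A) {t : ℝ≥0} (ht : 0 < (t : ℝ))
    (Q Q' : GaugeConfig 3 L (Matrix.specialUnitaryGroup (Fin 2) ℂ)) :
    |((κ t Q') A).toReal - ((κ t Q) A).toReal| ≤
      Real.sqrt ((1 - 12 * |β'|) / (Real.exp (2 * (1 - 12 * |β'|) * (t : ℝ)) - 1)) * Real.sqrt (torusRiemannDistSq (fundamentalLatticeRep 2) Q Q') := by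
  have hmeas : Measurable (A.indicator (1 : GaugeConfig 3 L (Matrix.specialUnitaryGroup (Fin 2) ℂ) → ℝ)) := measurable_const.indicator hA
  have h0 : ∀ y, 0 ≤ A.indicator (1 : GaugeConfig 3 L (Matrix.specialUnitaryGroup (Fin 2) ℂ) → ℝ) y := fun y =>
    Set.indicator_nonneg (fun _ _ => zero_le_one) y
  have h1 : ∀ y, A.indicator (1 : GaugeConfig 3 L (Matrix.specialUnitaryGroup (Fin 2) ℂ) → ℝ) y ≤ 1 := fun y => by
    by_cases hy : y ∈ A
    · rw [Set.indicator_of_mem hy, Pi.one_apply]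
    · rw [Set.indicator_of_notMem hy]; exact zero_le_one
  have h := wilson_strongFeller_measurable L β' hβ κ hreal hmeas (M := 1) h0 h1 ht Q Q'
  rw [integral_indicator_one hA, integral_indicator_one hA, mul_one] at h
  rwa [Measure.real, Measure.real] at h

/-! ## §2. Every-start total-variation ergodicity -/

/-- ★★★ **Every-start TOTAL-VARIATION geometric ergodicity, volume-uniform rate.**  For `|β'| < 1/12`, every `L`, every realising kernel family `κ`,
every start `Q`, every measurable `A`, `s > 0`, `t ≥ 0`:
`|κ_(t+s)(Q)(A) − μ_(β')(A)| ≤ √((1−12|β'|)/(e^(2(1−12|β'|)s) − 1))·e^(−(1−12|β'|)t)·∫ρ_L(Q,·)dμ_(β')` — Chapman–Kolmogorov `κ_(t+s) = κ_s ∘ κ_t`, invariance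
of `μ_(β')`, the set-wise strong Feller bound for `κ_s` (§1) and the `W₁` cold-start mixing of `κ_t` (G55). [cite: ShenZhuZhu2022, Theorem 4.2 (4.5)] -/
theorem wilson_tv_ergodicity_everyStart (L : ℕ) [NeZero L] (β' : ℝ) (hβ : |β'| < 1 / 12)
    (κ : ℝ≥0 → Kernel (GaugeConfig 3 L (Matrix.specialUnitaryGroup (Fin 2) ℂ))
      (GaugeConfig 3 L (Matrix.specialUnitaryGroup (Fin 2) ℂ))) [∀ t, IsMarkovKernel (κ t)]
    (hreal : ∀ (t : ℝ≥0) (x : GaugeConfig 3 L (Matrix.specialUnitaryGroup (Fin 2) ℂ))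
        (Ω : Type) [MeasurableSpace Ω] (P : Measure Ω) [IsProbabilityMeasure P]
        (W : ℝ≥0 → Ω → (Edge 3 L × NoiseIdx 2 → ℝ)) (hW : IsFlatBrownian W P)
        (U : ℝ≥0 → Ω → GaugeConfig 3 L (Matrix.specialUnitaryGroup (Fin 2) ℂ)),
        (∀ ω, U 0 ω = x) →
        (latticeLangevinDynamics (fundamentalLatticeRep 2) β').IsSolution (fundamentalRep (Fin 2))
          hW.natFiltration P W U →
        κ t x = P.map (U t))
    (Q : GaugeConfig 3 L (Matrix.specialUnitaryGroup (Fin 2) ℂ)) {A : Set (GaugeConfig 3 L (Matrix.specialUnitaryGroup (Fin 2) ℂ))} (hA : MeasurableSet A)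
    {s : ℝ≥0} (hs : 0 < (s : ℝ)) (t : ℝ≥0) :
    |((κ (t + s) Q) A).toReal - ((wilsonMeasure (d := 3) (L := L) (fundamentalRep (Fin 2)) β') A).toReal| ≤
      Real.sqrt ((1 - 12 * |β'|) / (Real.exp (2 * (1 - 12 * |β'|) * (s : ℝ)) - 1)) * Real.exp (-((1 - 12 * |β'|) * (t : ℝ))) *
        ∫ Q', Real.sqrt (torusRiemannDistSq (fundamentalLatticeRep 2) Q Q') ∂(wilsonMeasure (d := 3) (L := L) (fundamentalRep (Fin 2)) β') := by
  classical
  haveI := secondCountableTopology_su2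
  haveI := borelSpace_config L
  haveI : IsProbabilityMeasure (wilsonMeasure (d := 3) (L := L) (fundamentalRep (Fin 2)) β') :=
    isProbabilityMeasure_wilsonMeasure (d := 3) (L := L) (fundamentalRep (Fin 2)) (continuous_fundamentalRep (Fin 2)) β'
  -- the observable `F(y) = κ_s(y)(A)`: bounded, measurable, `C_s`-Lipschitz in `ρ_L`
  have hFm : Measurable fun y : GaugeConfig 3 L (Matrix.specialUnitaryGroup (Fin 2) ℂ) => ((κ s y) A).toReal :=
    ((κ s).measurable_coe hA).ennreal_toReal
  have hFlip : ∀ P P' : GaugeConfig 3 L (Matrix.specialUnitaryGroup (Fin 2) ℂ), |((κ s P') A).toReal - ((κ s P) A).toReal| ≤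
      Real.sqrt ((1 - 12 * |β'|) / (Real.exp (2 * (1 - 12 * |β'|) * (s : ℝ)) - 1)) * Real.sqrt (torusRiemannDistSq (fundamentalLatticeRep 2) P P') :=
    fun P P' => wilson_strongFeller_set L β' hβ κ hreal hA hs P P'
  have hmix := wilson_coldStart_W1_mixing_allLipschitz L (Real.sqrt_nonneg _) hFlip Q t β' hβ κ hreal
  -- Chapman–Kolmogorov: `κ_(t+s)(Q)(A) = ∫ κ_s(y)(A) dκ_t(Q)`
  have hCK : ((κ (t + s) Q) A).toReal = ∫ y, ((κ s y) A).toReal ∂(κ t Q) := by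
    rw [chapmanKolmogorov_szz β' κ hreal t s, Kernel.comp_apply' _ _ _ hA,
      integral_toReal ((κ s).measurable_coe hA).aemeasurable (ae_of_all _ fun y => measure_lt_top _ _)]
  -- invariance: `μ(A) = ∫ κ_s(y)(A) dμ`
  have hinv : ((wilsonMeasure (d := 3) (L := L) (fundamentalRep (Fin 2)) β') A).toReal =
      ∫ y, ((κ s y) A).toReal ∂(wilsonMeasure (d := 3) (L := L) (fundamentalRep (Fin 2)) β') := by
    have hb : (wilsonMeasure (d := 3) (L := L) (fundamentalRep (Fin 2)) β').bind (κ s) = wilsonMeasure (d := 3) (L := L) (fundamentalRep (Fin 2)) β' :=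
      (wilson_invariant_of_fact L β' (wilsonMeasureLangevinInvariant_su2 L β') κ hreal s).def
    conv_lhs => rw [← hb]
    rw [Measure.bind_apply hA (κ s).measurable.aemeasurable,
      integral_toReal ((κ s).measurable_coe hA).aemeasurable (ae_of_all _ fun y => measure_lt_top _ _)]
  rw [hCK, hinv]
  calc _ ≤ _ := hmix
    _ = _ := by ring

/-- ★★★ **Every-start total-variation ergodicity, diameter form**: `|κ_(t+s)(Q)(A) − μ_(β')(A)| ≤ C_s·e^(−(1−12|β'|)t)·√2·π·√#E` for all measurable
`A`, every start `Q`, `s > 0`, `t ≥ 0` (`ρ_L ≤ √2·π·√#E`). [cite: ShenZhuZhu2022, Theorem 4.2 (4.5)] -/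
theorem wilson_tv_ergodicity_everyStart_diam (L : ℕ) [NeZero L] (β' : ℝ) (hβ : |β'| < 1 / 12)
    (κ : ℝ≥0 → Kernel (GaugeConfig 3 L (Matrix.specialUnitaryGroup (Fin 2) ℂ))
      (GaugeConfig 3 L (Matrix.specialUnitaryGroup (Fin 2) ℂ))) [∀ t, IsMarkovKernel (κ t)]
    (hreal : ∀ (t : ℝ≥0) (x : GaugeConfig 3 L (Matrix.specialUnitaryGroup (Fin 2) ℂ))
        (Ω : Type) [MeasurableSpace Ω] (P : Measure Ω) [IsProbabilityMeasure P]
        (W : ℝ≥0 → Ω → (Edge 3 L × NoiseIdx 2 → ℝ)) (hW : IsFlatBrownian W P)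
        (U : ℝ≥0 → Ω → GaugeConfig 3 L (Matrix.specialUnitaryGroup (Fin 2) ℂ)),
        (∀ ω, U 0 ω = x) →
        (latticeLangevinDynamics (fundamentalLatticeRep 2) β').IsSolution (fundamentalRep (Fin 2))
          hW.natFiltration P W U →
        κ t x = P.map (U t))
    (Q : GaugeConfig 3 L (Matrix.specialUnitaryGroup (Fin 2) ℂ)) {A : Set (GaugeConfig 3 L (Matrix.specialUnitaryGroup (Fin 2) ℂ))} (hA : MeasurableSet A)
    {s : ℝ≥0} (hs : 0 < (s : ℝ)) (t : ℝ≥0) :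
    |((κ (t + s) Q) A).toReal - ((wilsonMeasure (d := 3) (L := L) (fundamentalRep (Fin 2)) β') A).toReal| ≤
      Real.sqrt ((1 - 12 * |β'|) / (Real.exp (2 * (1 - 12 * |β'|) * (s : ℝ)) - 1)) * Real.exp (-((1 - 12 * |β'|) * (t : ℝ))) *
        (Real.sqrt 2 * Real.pi * Real.sqrt (Fintype.card (Edge 3 L))) := by
  haveI := borelSpace_config L
  haveI : IsProbabilityMeasure (wilsonMeasure (d := 3) (L := L) (fundamentalRep (Fin 2)) β') :=
    isProbabilityMeasure_wilsonMeasure (d := 3) (L := L) (fundamentalRep (Fin 2)) (continuous_fundamentalRep (Fin 2)) β'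
  refine (wilson_tv_ergodicity_everyStart L β' hβ κ hreal Q hA hs t).trans (mul_le_mul_of_nonneg_left ?_ (by positivity))
  have hdiam : ∀ Q' : GaugeConfig 3 L (Matrix.specialUnitaryGroup (Fin 2) ℂ), Real.sqrt (torusRiemannDistSq (fundamentalLatticeRep 2) Q Q') ≤
      Real.sqrt 2 * Real.pi * Real.sqrt (Fintype.card (Edge 3 L)) := by
    intro Q'
    have h := torusRiemannDistSq_two_le_card Q Q'
    calc Real.sqrt (torusRiemannDistSq (fundamentalLatticeRep 2) Q Q') ≤ Real.sqrt (2 * Real.pi ^ 2 * Fintype.card (Edge 3 L)) := Real.sqrt_le_sqrt h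
      _ = Real.sqrt 2 * Real.pi * Real.sqrt (Fintype.card (Edge 3 L)) := by
          rw [Real.sqrt_mul (by positivity), Real.sqrt_mul (by norm_num), Real.sqrt_sq Real.pi_pos.le]
  have hρc : Continuous fun Q' : GaugeConfig 3 L (Matrix.specialUnitaryGroup (Fin 2) ℂ) => Real.sqrt (torusRiemannDistSq (fundamentalLatticeRep 2) Q Q') :=
    Real.continuous_sqrt.comp (continuous_torusRiemannDistSq_two_right Q)
  have hρi : Integrable (fun Q' : GaugeConfig 3 L (Matrix.specialUnitaryGroup (Fin 2) ℂ) => Real.sqrt (torusRiemannDistSq (fundamentalLatticeRep 2) Q Q')) (wilsonMeasure (d := 3) (L := L) (fundamentalRep (Fin 2)) β') :=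
    hρc.integrable_of_hasCompactSupport (HasCompactSupport.of_compactSpace _)
  calc ∫ Q', Real.sqrt (torusRiemannDistSq (fundamentalLatticeRep 2) Q Q') ∂(wilsonMeasure (d := 3) (L := L) (fundamentalRep (Fin 2)) β')
      ≤ ∫ _Q', Real.sqrt 2 * Real.pi * Real.sqrt (Fintype.card (Edge 3 L)) ∂(wilsonMeasure (d := 3) (L := L) (fundamentalRep (Fin 2)) β') := integral_mono hρi (integrable_const _) hdiam
    _ = Real.sqrt 2 * Real.pi * Real.sqrt (Fintype.card (Edge 3 L)) := by rw [integral_const, probReal_univ, one_smul]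

end Summit.QuantumFields.YangMills.Theorems.ColdStartUniversality

end
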